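import Summits.Ventures.CertifiedManyBodySolver.Downfold.RouterWordScoreFePnictideTypings

/-!
# Redundant alternatives of the §4.2 router-word score: MONO ≡ FEPAIR ≡ ORDPAIR and MIXPAIR ≡ UNION on every print
# (seat hubbard-downfold-score-2 gen 19; the curators' «PAIR vs MONO» typing switches are bookkeeping for the score)

Venture CertifiedManyBodySolver, cell `pub/hubbard-downfold`; namespace `Summit.Ventures.CertifiedManyBodySolver.Downfold.RouterScore`.
Everything here is PROVED (no `sorry`, standard axioms).

The v8 validation set types the d⁵ Mn rows MONO «UND:MULTIORB» (M450 · M477–M487, rulings R-tz / R-wc / R-wd / R-wi / R-wk), the Fe / Cr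
sheet rows FEPAIR «UND:MULTIORB+EPH | UND:MULTIORB» or ORDPAIR (the same two words in the other order), the Bi member M479 MIXPAIR
«UND:MIXED | UND:MULTIORB» (R-vu) and the LaFe₂As₂-UT class UNION «UND:MIXED+EPH | UND:MULTIORB+EPH | UND:MIXED | UND:MULTIORB». The
curators' drafts carry switches «PAIR | MONO», «ORDPAIR | FEPAIR», «MIXPAIR | UNION» and score-2's registrations said each time «reads
identically for every print». This file proves the general fact behind that sentence and the two identities as theorems:

* §1 `outcome_append_redundant` — appending to the expectation an alternative `a'` that is DOMINATED by an alternative `a` already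
  typed (same primary, and every token of `a` is a token of `a'`) changes NO verdict on ANY print: a full match of `a'` is a full match
  of `a`, the emitted-primary test reads the same head, and the structure gate reads only heads. (Contrast `outcome_agree_append_alts`
  in `RouterWordScore.lean`, which only says AGREE is preserved by appending anything.)
* §2 the identities: `score_fepair_eq_mono` (FEPAIR ≡ MONO «UND:MULTIORB» on every print — the «+EPH» compound word is dominated by
  the bare head), hence `score_ordpair_eq_mono`; `score_union_eq_mixpair` (UNION ≡ MIXPAIR); so the day's four d-typings collapse to
  TWO score classes — {MONO, FEPAIR, ORDPAIR} = «AGREE iff led by UND:MULTIORB» and {MIXPAIR, UNION} = «AGREE iff led by a d-head» —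
  plus TRIPLE (the only one under which a bare «EPH» is AGREE);
* §3 the instances the registrations quoted (BaMn₂Pn₂ P / As / Sb MONO vs Bi MIXPAIR: a straddle print costs DISAGREE on the MONO
  rows and nothing on the MIXPAIR row; the k-head print is AGREE under all five typings).

WHAT THIS IS NOT: not physics; not a typing ruling (which words the curators type stays theirs — this only shows which choices the
§4.2 letter can tell apart); not the scorer of record.
-/

namespace Summit.Ventures.CertifiedManyBodySolver.Downfold

namespace RouterScore

/-! ## §1 Dominated alternatives are redundant -/

section general

variable {α : Type*} [DecidableEq α] (structural : α → Bool)

/-- `a'` is DOMINATED by `a`: same primary and every token of `a` occurs in `a'` (so `a'` is at least as hard to match fully).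
[folklore] -/
def Dominates (a a' : List α) : Prop := a.head? = a'.head? ∧ ∀ t ∈ a, t ∈ a'

/-- a full match of the dominated word is a full match of the dominating one. [folklore] -/
theorem fullMatch_of_dominates {a a' e : List α} (h : Dominates a a') (hm : fullMatch e a' = true) :
    fullMatch e a = true := by
  simp only [fullMatch, covers, Bool.and_eq_true, decide_eq_true_eq, List.all_eq_true] at hm ⊢
  exact ⟨h.1.trans hm.1, fun t ht => hm.2 t (h.2 t ht)⟩

/-- the emitted-primary test reads the same head on both words. [folklore] -/
theorem primaryEmitted_eq_of_dominates {a a' : List α} (e : List α) (h : Dominates a a') :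
    primaryEmitted e a' = primaryEmitted e a := by
  unfold primaryEmitted; rw [← h.1]

/-- APPENDING A DOMINATED ALTERNATIVE CHANGES NO VERDICT ON ANY PRINT. [folklore] -/
theorem outcome_append_redundant (e : List α) {alts : List (List α)} {a a' : List α} (ha : a ∈ alts)
    (h : Dominates a a') : outcome structural e (alts ++ [a']) = outcome structural e alts := by
  cases e with
  | nil => rfl
  | cons p tl =>
    have hne : alts ≠ [] := List.ne_nil_of_mem ha
    have hexp : expectsStructural structural (alts ++ [a']) = expectsStructural structural alts := by
      unfold expectsStructural
      rw [List.any_append, List.any_cons, List.any_nil, Bool.or_false, ← h.1]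
      cases hv : alts.any (fun a => match a.head? with | some q => structural q | none => false) with
      | true => rfl
      | false =>
        rw [Bool.false_or]
        have := (List.any_eq_false.1 hv) a ha
        cases hh : a.head? with
        | none => rfl
        | some q => simp only [hh] at this ⊢; simpa using this
    have hfull : (alts ++ [a']).any (fullMatch (p :: tl)) = alts.any (fullMatch (p :: tl)) := by
      rw [List.any_append, List.any_cons, List.any_nil, Bool.or_false]
      cases hv : alts.any (fullMatch (p :: tl)) with
      | true => rfl
      | false =>
        rw [Bool.false_or]
        cases hm : fullMatch (p :: tl) a' with
        | false => rfl
        | true =>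
          have := (List.any_eq_false.1 hv) a ha
          exact absurd (fullMatch_of_dominates h hm) (by simpa using this)
    have hprim : (alts ++ [a']).any (primaryEmitted (p :: tl)) = alts.any (primaryEmitted (p :: tl)) := by
      rw [List.any_append, List.any_cons, List.any_nil, Bool.or_false, primaryEmitted_eq_of_dominates _ h]
      cases hv : alts.any (primaryEmitted (p :: tl)) with
      | true => rfl
      | false =>
        rw [Bool.false_or]
        have := (List.any_eq_false.1 hv) a ha
        simpa using this
    rw [outcome_cons, outcome_cons, if_neg hne, if_neg (by simp), hexp, hfull, hprim]

end general

open Head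

/-! ## §2 The identities: four d-typings, two score classes -/

/-- MONO «UND:MULTIORB» (M450, M477–M487). [folklore] -/
def mono : List (List Head) := [[undMultiorb]]

/-- MIXPAIR «UND:MIXED | UND:MULTIORB» (M479 BaMn₂Bi₂, R-vu). [folklore] -/
def mixpair : List (List Head) := [[undMixed], [undMultiorb]]

/-- «UND:MULTIORB+EPH» is dominated by «UND:MULTIORB». [folklore] -/
theorem dominates_khead_eph : Dominates [undMultiorb] [undMultiorb, eph] :=
  ⟨rfl, fun t ht => by simp only [List.mem_singleton] at ht; subst ht; exact List.mem_cons_self⟩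

/-- «UND:MIXED+EPH» is dominated by «UND:MIXED». [folklore] -/
theorem dominates_mixed_eph : Dominates [undMixed] [undMixed, eph] :=
  ⟨rfl, fun t ht => by simp only [List.mem_singleton] at ht; subst ht; exact List.mem_cons_self⟩

/-- FEPAIR ≡ MONO ON EVERY PRINT: the compound word «UND:MULTIORB+EPH» adds nothing the bare head does not already decide
(so R-tz's «PAIR ∣ MONO» switch and every FEPAIR-vs-MONO difference in the v8 slate is bookkeeping for §4.2). [folklore] -/
theorem score_fepair_eq_mono (e : List Head) : score e fepair = score e mono := by
  rw [score_ordpair_eq_fepair e |>.symm]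
  exact outcome_append_redundant Head.structural e (alts := mono) (List.mem_singleton_self _) dominates_khead_eph

/-- … hence ORDPAIR ≡ MONO too. [folklore] -/
theorem score_ordpair_eq_mono (e : List Head) : score e ordpair = score e mono := by
  rw [score_ordpair_eq_fepair, score_fepair_eq_mono]

/-- UNION ≡ MIXPAIR ON EVERY PRINT (both EPH-compound words are dominated by their bare heads). [folklore] -/
theorem score_union_eq_mixpair (e : List Head) : score e union = score e mixpair := by
  have h1 : score e ([[undMixed], [undMultiorb]] ++ [[undMixed, eph]]) = score e mixpair :=
    outcome_append_redundant Head.structural e (alts := mixpair) (by simp [mixpair]) dominates_mixed_eph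
  have h2 : score e (([[undMixed], [undMultiorb]] ++ [[undMixed, eph]]) ++ [[undMultiorb, eph]]) =
      score e ([[undMixed], [undMultiorb]] ++ [[undMixed, eph]]) :=
    outcome_append_redundant Head.structural e (alts := [[undMixed], [undMultiorb]] ++ [[undMixed, eph]])
      (by simp) dominates_khead_eph
  have h3 : score e union = score e (([[undMixed], [undMultiorb]] ++ [[undMixed, eph]]) ++ [[undMultiorb, eph]]) :=
    outcome_alts_congr Head.structural e (by
      intro a; simp only [union, List.cons_append, List.nil_append, List.mem_cons, List.not_mem_nil, or_false]; tauto)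
  rw [h3, h2, h1]

/-- MONO in closed form (from `score_fepair`): structural head abstains; led by «UND:MULTIORB» ⇒ AGREE; «UND:MULTIORB» riding
behind another head ⇒ PARTIAL; absent ⇒ DISAGREE. [folklore] -/
theorem score_mono (p : Head) (tl : List Head) :
    score (p :: tl) mono =
      (if p.structural then .ABSTAIN_structure
       else if p = undMultiorb then .AGREE
       else if undMultiorb ∈ tl then .PARTIAL else .DISAGREE) := by
  rw [← score_fepair_eq_mono, score_fepair]

/-- MIXPAIR in closed form (from `score_union`): led by either d-head ⇒ AGREE; a d-head riding ⇒ PARTIAL; none ⇒ DISAGREE.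
[folklore] -/
theorem score_mixpair (p : Head) (tl : List Head) :
    score (p :: tl) mixpair =
      (if p.structural then .ABSTAIN_structure
       else if p = undMultiorb ∨ p = undMixed then .AGREE
       else if undMultiorb ∈ tl ∨ undMixed ∈ tl then .PARTIAL else .DISAGREE) := by
  rw [← score_union_eq_mixpair, score_union]

/-! ## §3 The instances the registrations quoted (BaMn₂Pn₂ series, R-vu) -/

/-- The k-head print of the day «UND:MULTIORB(k=5; J_H)+EPH» is AGREE under MONO, MIXPAIR, FEPAIR, ORDPAIR and UNION alike;
a straddle print «UND:MIXED(…)+EPH» costs DISAGREE on the MONO rows (P / As / Sb) and nothing on the MIXPAIR row (Bi); a bare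
«EPH» is DISAGREE under both; a «BI» head alone DISAGREE, with the k-head riding PARTIAL. [folklore] -/
theorem bamn2pn2_series :
    (score [undMultiorb, eph] mono = .AGREE ∧ score [undMultiorb, eph] mixpair = .AGREE) ∧
    (score [undMixed, eph] mono = .DISAGREE ∧ score [undMixed, eph] mixpair = .AGREE) ∧
    (score [eph] mono = .DISAGREE ∧ score [eph] mixpair = .DISAGREE) ∧
    (score [bi] mono = .DISAGREE ∧ score [bi, undMultiorb] mono = .PARTIAL ∧ score [bi, undMultiorb] mixpair = .PARTIAL) := by
  decide

end RouterScore

end Summit.Ventures.CertifiedManyBodySolver.Downfold
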